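import Summits.QuantumFields.BalabanUV.T4Continuum.Support.B13KPStepTermCensus

/-!
# NE5 ∕ U3, route P2 — THE ARITHMETIC CENSUS of route P2's END on Bałaban's carriers of record, part 2 of 2 (skeleton
# `t4/skeletons/NE5-t4-ne5-p2.md` §6 row A5): the END of record AT the threshold off resonance, and the census face AT W1's INPUT RATE `θ`
# ITSELF when the age damping is faster (`ω < θ`) — «the route then delivers the input rate itself»

Cell `pub-balaban`, unit `b2b-balaban-t4-ne5-p2` (NE5 ∕ U3 PROVER seat P2 «polymer-activity Lipschitz ∕ Kotecký–Preiss route», lineage gen 20).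
Summits-side new work (cell bookkeeping; NOT a Literature module; nothing of the manuscripts is asserted).  HONEST FRAMING: rung (B)+1 of the
FINITE-VOLUME T⁴ programme — NOT infinite volume, NOT mass gap, NOT Clay, **NOT A PROOF OF NE5** (spine 0∕9): an implication from displayed binders
over NAMED-PARAMETER cores and constants.  HONEST DEPENDENCY (cell line, verbatim): continuum YM on T⁴ ⇐ BetaPertH ∧ nine spine estimates (0/9
proved); BetaPertH ⇐ (D1) ∧ (D4) ∧ CAP+tail; G-an2-4 gates asym, D1 and NE2/3/4.

WHAT.  Part 1 (`B13KPStepTermCensus`) replaced the twenty-four numeric binders of route P2's END of record on the measurable slot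
(`B13KPStepTermMeasurableLetters.ne5_above_max_record_measOp_letters`, p215092) by explicit witnesses (`census_arith`) under ONE rate room and ONE
amplitude inequality, at every rate `θ′ > max(θ, ω)`.  Here:
* §1 **`ne5_at_max_record_measOp`** — the twin of `B13KPStepTermMeasurable.ne5_above_max_record_measOp` (p215035) AT the threshold `max(θ, r_fb)`
  OFF RESONANCE (`θ ≠ r_fb`), through K7's `TermFamily.ne5_at_max_of_model_reach_step`; same displayed list and the same discharges (MI-R, L07,
  L08a∕b, L03-geometry, L09 ×2 at the derived level `64τe^{−5σ}`, the insertion structure, R-IDENT's window binders);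
* §2 **`ne5_at_inputRate_record_measOp_census`** — when `ω < θ` (W3's age damping per step beats W1's rate): with part 1's witnesses and the
  amplitude inequality read at the rate target `t := θ`,
    `A_m·K₁ ≤ min( e^{−5·max(ϰ+1,1)}, ρ₀(1 − ω)∕(512·Mr·(c + 1)), (θ − ω)∕(128·(Λhist·c + 1)), E_ins∕64 )`,
  the fed-back rate `r_fb = ω + 64·A_m·K₁·Λhist·c` is `< θ`, hence off resonance with `max(θ, r_fb) = θ`, and §1 gives
  `∃ C₅, NE5 (outA …) (outB …) W ϰ θ C₅` — NE5 AT W1's RATE `θ` with NO loss; same analytic display as p215092 (per catalogued term of record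
  `Admissible`, `GeometryCore`, the B13-format letters, measurability side conditions, `RefAt` ×2, ONE (2.38)-shaped inequality; W1∕W4∕W3 of the
  step of record; the holder's transport reading).
READING: as in part 1 — (AMPLITUDE) = «ε₁ sufficiently small» with the `θ − ω` dependence displayed, (RATE ROOM) = «κ sufficiently large» ([II] p. 21).
NOT NE5: the analytic binders are untouched.  0 sorry; axioms ⊆ {propext, Classical.choice, Quot.sound}.
-/

noncomputable section

open MeasureTheory
open scoped BigOperators

namespace Summit.QuantumFields.BalabanUV.T4Continuum.B13KPStepTermCensusAtRate

open Literature.MathematicalPhysics.QuantumFieldTheory.Balaban1983to89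
open Literature.MathematicalPhysics.QuantumFieldTheory.Balaban1983to89.T4OutputRate (Carriers Functional DecayBound NE5)
open Literature.MathematicalPhysics.QuantumFieldTheory.Balaban1983to89.T4InputCauchyRateData (StepModel)
open Summit.QuantumFields.BalabanUV.T4Continuum.ActivityTermModel (TermDatum TermConsts TermFamily)
open Summit.QuantumFields.BalabanUV.T4Continuum.B13Carriers (TwoRuns)
open Summit.QuantumFields.BalabanUV.T4Continuum.ClusterRepOfDomains (DomainGeometry)
open Summit.QuantumFields.BalabanUV.T4Continuum.B13DomainGeometryTR (domainGeometry clusterRep decayExtract_b13 pinBudget_b13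
  kpInflated_b13)
open Summit.QuantumFields.BalabanUV.T4Continuum.B13InnerData (b13InnerData Bnd)
open Summit.QuantumFields.BalabanUV.T4Continuum.B13OpDatum (OpDatum Species B13Weights)
open Summit.QuantumFields.BalabanUV.T4Continuum.B13HistDatum (level136)
open Summit.QuantumFields.BalabanUV.T4Continuum.B13HistMeasurable (MeasPotFrame B13HistM)
open Summit.QuantumFields.BalabanUV.T4Continuum.B13StepOfRecord (step outA outB assembly)
open Summit.QuantumFields.BalabanUV.T4Continuum.B13StepTermLabels (InnerLabel innerLabels)
open Summit.QuantumFields.BalabanUV.T4Continuum.B13OutKPFormRecord (LevelSummable ClusAbsConv)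
open Summit.QuantumFields.BalabanUV.T4Continuum.B13KPStepOfRecord (outA_KP outB_KP rhoA rhoB inputA_KP inputB_KP represents_kp
  ne5_above_max_record_of_kp)
open Summit.QuantumFields.BalabanUV.T4Continuum.B13TermData (TermCore termData)
open Summit.QuantumFields.BalabanUV.T4Continuum.B13StepOfRecordTermData (TermSlots)
open Summit.QuantumFields.BalabanUV.T4Continuum.B13KPStepTermWindow (window_of_majorant decayBoundA_of_baseMajorant
  outA_KP_of_not_transport)
open Summit.QuantumFields.BalabanUV.T4Continuum.B13OpMeasurable (measOp)
open Summit.QuantumFields.BalabanUV.T4Continuum.B13KPStepTermMeasurable (termFamilyM stepOnSub wellFormed_M readsStep_M realizes_M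
  inBase_M actNorm_le_majorant_M structure_onSub operatorRate_onSub insertionRate_onSub insScaleBound_onSub)
open Summit.QuantumFields.BalabanUV.T4Continuum.B13KPStepTermLetters (G₀ termMajorant termMajorant_nonneg)
open Summit.QuantumFields.BalabanUV.T4Continuum.B13KPStepTermMeasurableLetters (hsum_termMajorant_M)
open Summit.QuantumFields.BalabanUV.T4Continuum.B13KPStepTermCensus (insertionRate_of_level_le census_arith)

variable {𝔾 : Type} [GaugeGroup 𝔾] {R : TwoRuns 𝔾} {P : MeasPotFrame R.carriers} {𝒴 : Type*} {dom : 𝒴 → R.carriers.Dom}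
  {T κ ι S Ω Ω₀ 𝒞 IOp : Type*} [MeasurableSpace Ω] [MeasurableSpace Ω₀] [Fintype ι] [Fintype κ] [DecidableEq ι] [DecidableEq κ]
  (𝔖 : TermSlots R P dom T κ ι S Ω Ω₀ 𝒞 IOp) (E₀ cB : ℝ)
  (hA : ∀ g U k, (step 𝔖.toSlots E₀ cB).opA g U k ∈ measOp T κ ι Ω 𝒴)
  (hB : ∀ g U k, (step 𝔖.toSlots E₀ cB).opB g U k ∈ measOp T κ ι Ω 𝒴)
  (𝔡 : R.carriers.Dom → InnerLabel R.carriers.Dom (Bnd R) → TermConsts)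

/-! ## §1 The END of record AT the threshold, off resonance -/

variable [DecidableEq 𝒞]

/-- [folklore] **ROUTE P2's END ON THE MEASURABLE SLOT AT THE THRESHOLD `max(θ, r_fb)`, OFF RESONANCE** — the twin of
`B13KPStepTermMeasurable.ne5_above_max_record_measOp` with K7's `TermFamily.ne5_at_max_of_model_reach_step` in place of the above-max face:
under `θ ≠ r_fb := ω + 64τe^{−5σ}·Λhist∕(s − Λhist·ρ₀′)·c` the conclusion is `∃ C₅, NE5 (outA …) (outB …) W ϰ (max θ r_fb) C₅`.  Same displayed
list and the same discharges (MI-R, L07, L08a∕b, L03-geometry, L09 ×2 at the derived level `64τe^{−5σ}`, the insertion structure, R-IDENT's window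
binders).  NOT a proof of NE5; cores and constants are NAMED PARAMETERS. -/
theorem ne5_at_max_record_measOp (hT : (assembly 𝔖.toSlots).TransportReads Set.univ) {W : Set (ℕ → ℝ)}
    {m : (ℕ → ℝ) → R.carriers.BgB → R.carriers.Dom → ℝ}
    {A_m R_m τ σ s E₁ ϰ θ δ δ' c ω Λop Λhist ρ₀ ρ₀' : ℝ}
    (hA_m : 0 ≤ A_m) (hτ : 0 ≤ τ) (hσ : 0 ≤ σ) (hs0 : 0 ≤ s)
    (hm0 : ∀ (g : ℕ → ℝ) (U : R.carriers.BgB) (Z : R.carriers.Dom), 0 ≤ m g U Z)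
    (hm : ∀ g ∈ W, ∀ (U : R.carriers.BgB) (k : ℕ), ∀ Z ∈ R.domAt k, m g U Z ≤ A_m * Real.exp (-(R_m * R.carriers.d Z)))
    (hrate : 64 * Real.log 162 + σ + τ * 64 ≤ R_m)
    (hsmall : (1 + s) * A_m * Real.exp (σ * 5 + τ * 64) * B12TreeDecay.K₀ (4 * 2 ^ 4) (2 * 4) * 9 ≤ τ) (hσκ : ϰ + 1 ≤ σ)
    (hrate' : 64 * Real.log 162 + 64 ≤ R_m) (hsmall' : 36 * (A_m * Real.exp 64 * B12TreeDecay.K₀ (4 * 2 ^ 4) (2 * 4)) < 1)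
    (hadm : ∀ k, ∀ Z ∈ (domainGeometry R).level k, ∀ ℓ ∈ innerLabels (b13InnerData R) k Z, (𝔡 Z ℓ).Admissible)
    (hcore : ∀ k, ∀ Z ∈ (domainGeometry R).level k, ∀ ℓ ∈ innerLabels (b13InnerData R) k Z,
      (termData 𝔖.F 𝔖.G 𝔖.rHist 𝔖.core Z ℓ).GeometryCore (𝔡 Z ℓ))
    (hlip : ∀ k, ∀ Z ∈ (domainGeometry R).level k, ∀ ℓ ∈ innerLabels (b13InnerData R) k Z,
      (termData 𝔖.F 𝔖.G 𝔖.rHist 𝔖.core Z ℓ).ReadLip (𝔡 Z ℓ) (𝔖.rOp (R.carriers.scale Z)) (𝔖.rHist (R.carriers.scale Z)))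
    (hXf : ∀ Z ℓ i, Measurable fun x => (𝔖.core Z ℓ).Xf x i) (hBf : ∀ Z ℓ a, Measurable fun x => (𝔖.core Z ℓ).Bf x a)
    (hFQ : ∀ k (Y : 𝒴) (b b' : κ), Measurable fun x : Ω => (𝔖.F k).wt (.potQ x Y b b'))
    (hFR : ∀ k (Y : 𝒴), Measurable fun x : Ω => (𝔖.F k).wt (.potR x Y))
    (hsum : ∀ g ∈ W, ∀ (U : R.carriers.BgB) (X : R.carriers.Dom), ∀ Z ∈ (domainGeometry R).level (R.carriers.scale X),
      ∑ ℓ ∈ innerLabels (b13InnerData R) (R.carriers.scale X) Z, (termFamilyM 𝔖 E₀ cB hA hB 𝔡).G Λop Λhist ρ₀ g U X Z ℓ ≤ m g U Z)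
    (hρ₁ : ρ₀ ≤ 1)
    (hRef : ∀ g ∈ W, ∀ (U : R.carriers.BgB) (X : R.carriers.Dom),
      ∀ Z ∈ (domainGeometry R).level (R.carriers.scale X), ∀ ℓ ∈ innerLabels (b13InnerData R) (R.carriers.scale X) Z,
        (termData 𝔖.F 𝔖.G 𝔖.rHist 𝔖.core Z ℓ).RefAt (𝔡 Z ℓ) (inputB_KP 𝔖.toSlots E₀ cB g U X))
    (hRefA : ∀ g ∈ W, ∀ (U : R.carriers.BgB) (X : R.carriers.Dom),
      ∀ Z ∈ (domainGeometry R).level (R.carriers.scale X), ∀ ℓ ∈ innerLabels (b13InnerData R) (R.carriers.scale X) Z,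
        (termData 𝔖.F 𝔖.G 𝔖.rHist 𝔖.core Z ℓ).RefAt (𝔡 Z ℓ) (inputA_KP 𝔖.toSlots E₀ cB g U X))
    (hop : (step 𝔖.toSlots E₀ cB).OperatorRate W δ θ)
    (hins : (step 𝔖.toSlots E₀ cB).InsertionRate W ϰ (τ * 64 * Real.exp (-(σ * 5))) δ' θ)
    (hunit : (step 𝔖.toSlots E₀ cB).InsScaleBound W ϰ E₁ c ω)
    (hE₁ : 0 < E₁) (hΛop : 0 < Λop) (hΛhist : 0 < Λhist) (hρ : max (Λhist / Λop) 1 * ρ₀' ≤ ρ₀)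
    (hs : Λhist * ρ₀' < s) (hδ : 0 ≤ δ) (hδ' : 0 ≤ δ') (hθ : 0 ≤ θ) (hθ1 : θ < 1)
    (hc : 0 ≤ c) (hω : 0 < ω) (hω1 : ω < 1)
    (hreach : c * (τ * 64 * Real.exp (-(σ * 5)) + τ * 64 * Real.exp (-(σ * 5))) / (1 - ω) < ρ₀')
    (hres : θ ≠ ω + (τ * 64 * Real.exp (-(σ * 5))) * Λhist / (s - Λhist * ρ₀') * c) :
    ∃ C₅, NE5 (outA 𝔖.toSlots E₀ cB) (outB 𝔖.toSlots E₀ cB) W ϰ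
      (max θ (ω + (τ * 64 * Real.exp (-(σ * 5))) * Λhist / (s - Λhist * ρ₀') * c)) C₅ := by
  have hwf := wellFormed_M 𝔖 E₀ cB hA hB 𝔡 W hadm hcore hlip hXf hBf hFQ hFR
  have hrep := represents_kp 𝔖.toSlots E₀ cB hT
  have hreal := realizes_M 𝔖 E₀ cB hA hB 𝔡 W
  have hbase := inBase_M 𝔖 E₀ cB hA hB 𝔡 hRef
  have hmaj := (termFamilyM 𝔖 E₀ cB hA hB 𝔡).baseMajorant_model hwf hΛop hΛhist hsum
  have hKP := kpInflated_b13 (rhoA 𝔖.toSlots E₀ cB) (rhoB 𝔖.toSlots E₀ cB) hA_m hτ hσ hs0 hm0 hm hrate hsmall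
  have hdec := decayExtract_b13 (rhoA 𝔖.toSlots E₀ cB) (rhoB 𝔖.toSlots E₀ cB) hσ
  have hpin := pinBudget_b13 (rhoA 𝔖.toSlots E₀ cB) (rhoB 𝔖.toSlots E₀ cB) hτ hσκ
  -- the two levels (L09) at the derived level `64τe^{−5σ}`
  have hdB : DecayBound (outB_KP 𝔖.toSlots E₀ cB) W (τ * 64 * Real.exp (-(σ * 5))) ϰ :=
    (termFamilyM 𝔖 E₀ cB hA hB 𝔡).model.decayBound_of_baseMajorant hrep hreal hbase hmaj hKP hs0 hdec hpin
  have hdA : DecayBound (outA_KP 𝔖.toSlots E₀ cB) W (τ * 64 * Real.exp (-(σ * 5))) ϰ :=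
    decayBoundA_of_baseMajorant (termFamilyM 𝔖 E₀ cB hA hB 𝔡).model hrep hreal (fun g hg U X Z hZ ℓ hℓ =>
      (termData 𝔖.F 𝔖.G 𝔖.rHist 𝔖.core Z ℓ).refAt_onSub (measOp T κ ι Ω 𝒴) (hRefA g hg U X Z hZ ℓ hℓ)) hmaj hKP hs0 hdec hpin
      (by positivity) fun g _ V hV X => outA_KP_of_not_transport 𝔖.toSlots E₀ cB hV X
  -- R-IDENT's window binders at both runs' input points
  have hwinA : ∀ g ∈ W, ∀ (U : R.carriers.BgB) (X : R.carriers.Dom),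
      LevelSummable 𝔖.toSlots X (inputA_KP 𝔖.toSlots E₀ cB g U X) ∧ ClusAbsConv 𝔖.toSlots X (inputA_KP 𝔖.toSlots E₀ cB g U X) :=
    fun g hg U X => window_of_majorant 𝔖.toSlots hA_m
      (actNorm_le_majorant_M 𝔖 E₀ cB hA hB 𝔡 hΛop hΛhist hadm hsum hm hg U X (hRefA g hg U X)) hrate' hsmall'
  have hwinB : ∀ g ∈ W, ∀ (U : R.carriers.BgB) (X : R.carriers.Dom),
      LevelSummable 𝔖.toSlots X (inputB_KP 𝔖.toSlots E₀ cB g U X) ∧ ClusAbsConv 𝔖.toSlots X (inputB_KP 𝔖.toSlots E₀ cB g U X) :=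
    fun g hg U X => window_of_majorant 𝔖.toSlots hA_m
      (actNorm_le_majorant_M 𝔖 E₀ cB hA hB 𝔡 hΛop hΛhist hadm hsum hm hg U X (hRef g hg U X)) hrate' hsmall'
  obtain ⟨haffN, hblindN, hhomN⟩ := structure_onSub 𝔖 E₀ cB hA hB W
  refine ne5_above_max_record_of_kp 𝔖.toSlots E₀ cB hT (fun g hg U X => (hwinA g hg U X).1) (fun g hg U X => (hwinA g hg U X).2)
    (fun g hg U X => (hwinB g hg U X).1) (fun g hg U X => (hwinB g hg U X).2) ?_
  exact ActivityStepJunction.TermFamily.ne5_at_max_of_model_reach_step (termFamilyM 𝔖 E₀ cB hA hB 𝔡)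
    (readsStep_M 𝔖 E₀ cB hA hB 𝔡) hwf hsum hρ₁ hrep hreal hbase hKP hdec hpin hdA hdB
    (operatorRate_onSub 𝔖 E₀ cB hA hB hop) (insertionRate_onSub 𝔖 E₀ cB hA hB hins) haffN hblindN hhomN
    (insScaleBound_onSub 𝔖 E₀ cB hA hB hunit) hE₁ (by positivity) hΛop hΛhist hρ hs hδ hδ' hθ hθ1 hc hω hω1 hreach hres

/-! ## §2 The census END face AT W1's input rate -/

include hA hB in
/-- [folklore] **ROUTE P2's END ON BAŁABAN's CARRIERS OF RECORD AT W1's INPUT RATE `θ` ITSELF — THE ARITHMETIC CENSUS FORM** (the skeleton's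
«the route then delivers the input rate itself»).  When the age damping is FASTER than the input rate, `ω < θ`, the same display as
`ne5_record_measOp_census` with the amplitude inequality read at the rate target `t := θ`
(`A_m·K₁ ≤ min(e^{−5σ}, ρ₀(1−ω)∕(512·Mr·(c+1)), (θ−ω)∕(128·(Λhist·c+1)), E_ins∕64)`) gives `∃ C₅, NE5 (outA …) (outB …) W ϰ θ C₅`: the fed-back
rate `r_fb < θ` is then off resonance and below W1's rate (§1 `ne5_at_max_record_measOp`, `max θ r_fb = θ`).  NOT a proof of NE5. -/
theorem ne5_at_inputRate_record_measOp_census (hT : (assembly 𝔖.toSlots).TransportReads Set.univ) {W : Set (ℕ → ℝ)}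
    (hF : ∀ k, 𝔖.F k = (𝔖.G k).format) {lamR : ℝ}
    {A_m R_m E₁ Eins ϰ θ δ δ' c ω Λop Λhist ρ₀ : ℝ}
    (hadm : ∀ k, ∀ Z ∈ (domainGeometry R).level k, ∀ ℓ ∈ innerLabels (b13InnerData R) k Z, (𝔡 Z ℓ).Admissible)
    (hcore : ∀ k, ∀ Z ∈ (domainGeometry R).level k, ∀ ℓ ∈ innerLabels (b13InnerData R) k Z,
      (termData 𝔖.F 𝔖.G 𝔖.rHist 𝔖.core Z ℓ).GeometryCore (𝔡 Z ℓ))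
    (hδ : ∀ k, ∀ Z ∈ (domainGeometry R).level k, ∀ ℓ ∈ innerLabels (b13InnerData R) k Z, (𝔖.G k).δ = (𝔡 Z ℓ).δ)
    (hvR : ∀ k, ∀ Z ∈ (domainGeometry R).level k, ∀ ℓ ∈ innerLabels (b13InnerData R) k Z, ∀ Y ∈ (𝔖.core Z ℓ).D,
      (𝔖.G k).v Y ≤ lamR * (𝔖.rHist k * (‖(𝔖.G k).τ Y‖ * level136 P.consts (R.carriers.d (dom Y)))))
    (hκL : ∀ k, ∀ Z ∈ (domainGeometry R).level k, ∀ ℓ ∈ innerLabels (b13InnerData R) k Z, 𝔖.rOp k ≤ (𝔡 Z ℓ).κL)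
    (hκA : ∀ k, ∀ Z ∈ (domainGeometry R).level k, ∀ ℓ ∈ innerLabels (b13InnerData R) k Z, 𝔖.rOp k ≤ (𝔡 Z ℓ).κA)
    (hκP : ∀ k, ∀ Z ∈ (domainGeometry R).level k, ∀ ℓ ∈ innerLabels (b13InnerData R) k Z, 𝔖.rOp k ≤ (𝔡 Z ℓ).κP)
    (hκQ : ∀ k, ∀ Z ∈ (domainGeometry R).level k, ∀ ℓ ∈ innerLabels (b13InnerData R) k Z, 𝔖.rOp k ≤ (𝔡 Z ℓ).κQ)
    (hκR : ∀ k, ∀ Z ∈ (domainGeometry R).level k, ∀ ℓ ∈ innerLabels (b13InnerData R) k Z, 𝔖.rOp k * lamR ≤ (𝔡 Z ℓ).κR)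
    (hXf : ∀ Z ℓ i, Measurable fun x => (𝔖.core Z ℓ).Xf x i) (hBf : ∀ Z ℓ a, Measurable fun x => (𝔖.core Z ℓ).Bf x a)
    (h238 : ∀ k, ∀ Z ∈ (domainGeometry R).level k,
      ∑ ℓ ∈ innerLabels (b13InnerData R) k Z, G₀ 𝔖 𝔡 Λop Λhist ρ₀ Z ℓ ≤ A_m * Real.exp (-(R_m * R.carriers.d Z)))
    (hRef : ∀ g ∈ W, ∀ (U : R.carriers.BgB) (X : R.carriers.Dom),
      ∀ Z ∈ (domainGeometry R).level (R.carriers.scale X), ∀ ℓ ∈ innerLabels (b13InnerData R) (R.carriers.scale X) Z,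
        (termData 𝔖.F 𝔖.G 𝔖.rHist 𝔖.core Z ℓ).RefAt (𝔡 Z ℓ) (inputB_KP 𝔖.toSlots E₀ cB g U X))
    (hRefA : ∀ g ∈ W, ∀ (U : R.carriers.BgB) (X : R.carriers.Dom),
      ∀ Z ∈ (domainGeometry R).level (R.carriers.scale X), ∀ ℓ ∈ innerLabels (b13InnerData R) (R.carriers.scale X) Z,
        (termData 𝔖.F 𝔖.G 𝔖.rHist 𝔖.core Z ℓ).RefAt (𝔡 Z ℓ) (inputA_KP 𝔖.toSlots E₀ cB g U X))
    (hop : (step 𝔖.toSlots E₀ cB).OperatorRate W δ θ)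
    (hins : (step 𝔖.toSlots E₀ cB).InsertionRate W ϰ Eins δ' θ)
    (hunit : (step 𝔖.toSlots E₀ cB).InsScaleBound W ϰ E₁ c ω)
    (hE₁ : 0 < E₁) (hΛop : 0 < Λop) (hΛhist : 0 < Λhist) (hρ₀ : 0 < ρ₀) (hρ₁ : ρ₀ ≤ 1)
    (hδ0 : 0 ≤ δ) (hδ' : 0 ≤ δ') (hθ : 0 ≤ θ) (hθ1 : θ < 1) (hc : 0 ≤ c) (hω : 0 < ω) (hω1 : ω < 1) (hA_m : 0 ≤ A_m)
    -- THE CENSUS at the rate target `θ`: one rate room, the age damping faster than the input rate, one amplitude inequality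
    (hR : 64 * Real.log 162 + max (ϰ + 1) 1 + 64 ≤ R_m) (hωθ : ω < θ)
    (hAm : A_m * ((2 + Λhist) * 9 * B12TreeDecay.K₀ (4 * 2 ^ 4) (2 * 4) * Real.exp 64) ≤
      min (min (Real.exp (-(max (ϰ + 1) 1 * 5))) (ρ₀ * (1 - ω) / (512 * max (Λhist / Λop) 1 * (c + 1))))
        (min ((θ - ω) / (128 * (Λhist * c + 1))) (Eins / 64))) :
    ∃ C₅, NE5 (outA 𝔖.toSlots E₀ cB) (outB 𝔖.toSlots E₀ cB) W ϰ θ C₅ := by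
  obtain ⟨τ, σ, s, ρ₀', hτ, hσ, hs0, hrate, hsmall, hσκ, hrate', hsmall', hρ, hs, hreach, hfb, hlev⟩ :=
    census_arith (B12TreeDecay.K₀_pos _ _) hA_m hΛop hΛhist hρ₀ hρ₁ hc hω1 hωθ hR hAm
  -- `ReadLip` in the term's own-scale margins from the format letters, the formats' potential weights are constants, `hm` from `h238`
  have hlip : ∀ k, ∀ Z ∈ (domainGeometry R).level k, ∀ ℓ ∈ innerLabels (b13InnerData R) k Z,
      (termData 𝔖.F 𝔖.G 𝔖.rHist 𝔖.core Z ℓ).ReadLip (𝔡 Z ℓ) (𝔖.rOp (R.carriers.scale Z)) (𝔖.rHist (R.carriers.scale Z)) := by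
    intro k Z hZ ℓ hℓ
    have hsc : R.carriers.scale Z = k := ((domainGeometry R).mem_level Z _).1 hZ
    unfold termData
    rw [hsc, hF k]
    exact B13OpMeasurable.readLip_toTermDatum_signs (𝔖.core Z ℓ) (𝔖.G k) (𝔖.rHist k) (𝔡 Z ℓ) (hδ k Z hZ ℓ hℓ) (hvR k Z hZ ℓ hℓ)
      (𝔖.rOp_pos k) (𝔖.rHist_pos k) (hκL k Z hZ ℓ hℓ) (hκA k Z hZ ℓ hℓ) (hκP k Z hZ ℓ hℓ) (hκQ k Z hZ ℓ hℓ) (hκR k Z hZ ℓ hℓ)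
  have hFQ : ∀ k (Y : 𝒴) (b b' : κ), Measurable fun x : Ω => (𝔖.F k).wt (.potQ x Y b b') := fun k Y b b' => by
    simp only [hF k, B13Weights.format_wt, B13Weights.wt]; exact measurable_const
  have hFR : ∀ k (Y : 𝒴), Measurable fun x : Ω => (𝔖.F k).wt (.potR x Y) := fun k Y => by
    simp only [hF k, B13Weights.format_wt, B13Weights.wt]; exact measurable_const
  have hm : ∀ g ∈ W, ∀ (U : R.carriers.BgB) (k : ℕ), ∀ Z ∈ R.domAt k,
      termMajorant 𝔖 𝔡 Λop Λhist ρ₀ g U Z ≤ A_m * Real.exp (-(R_m * R.carriers.d Z)) := by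
    intro g _ U k Z hZ
    have hsc : R.carriers.scale Z = k := ((domainGeometry R).mem_level Z _).1 hZ
    have h := h238 k Z hZ
    unfold termMajorant
    rw [hsc]
    exact h
  have hne : θ ≠ ω + (τ * 64 * Real.exp (-(σ * 5))) * Λhist / (s - Λhist * ρ₀') * c := ne_of_gt hfb
  have hmax : max θ (ω + (τ * 64 * Real.exp (-(σ * 5))) * Λhist / (s - Λhist * ρ₀') * c) = θ := max_eq_left hfb.le
  rw [← hmax]
  exact ne5_at_max_record_measOp 𝔖 E₀ cB hA hB 𝔡 hT hA_m hτ hσ hs0 (termMajorant_nonneg 𝔖 𝔡 hΛop hΛhist hadm) hm hrate hsmall hσκ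
    hrate' hsmall' hadm hcore hlip hXf hBf hFQ hFR (hsum_termMajorant_M 𝔖 E₀ cB hA hB 𝔡 W) hρ₁ hRef hRefA hop
    (insertionRate_of_level_le _ hins hlev) hunit hE₁ hΛop hΛhist hρ hs hδ0 hδ' hθ hθ1 hc hω hω1 hreach hne

end Summit.QuantumFields.BalabanUV.T4Continuum.B13KPStepTermCensusAtRate

end
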